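import Mathlib
import Summits.ValiantsHypothesis.ValiantsHypothesis.Theorems.FifoMatchingNFPolytopeQueueGridGadgetPositions
import Summits.ValiantsHypothesis.ValiantsHypothesis.Theorems.FifoMatchingNFPolytopeQueueGridFaceFifo
import HarnessLib

/-!
# Route `FifoMatching`, item `NFPolytopeQuasiPolyXC` (K1, stmt-26254), line `queue_grid_face`, INPUT (A):
# rigidity toolkit — virtual coordinates, the arc rule unpacked, and the per-window FEEDING LEMMA

For a nest-free perfect matching `M` of `Fin (2 · half r d)` all of whose arcs are allowed arcs of layout B
(`(p, M p) ∈ allowed r d` for every opener `p`):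

* virtual-coordinate bookkeeping: the position is a function of the virtual cell coordinates (`toNat_eq_of_vc`), which
  are therefore injective (`eq_of_vc_eq`), bounded (`vc_spec`) and ordered by column inside a virtual stretch
  (`toNat_lt_of_vc`); the arc relation unpacked (`adj_eq_true_iff`, `adjV_eq_true_iff`);
* the FIFO monotonicity of a nest-free matching (`apply_lt_apply_of_lt`) and the arcs at openers / closers in symbolic
  form (`adj_of_lt`, `adj_of_gt`);
* **`window_pattern` (the feeding lemma)**: if the two feeders of window `(s, i)` — the unique opener `A` in virtual
  cell class `(s, i, odd)` and the unique opener `B` in class `(s, i+1, even)`, `A` before `B` — exist, then the window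
  reads `UUDD` or `DDUU`: slot `t` is an opener iff (`t < 2` iff slot `0` is an opener).  FIFO kills `UDDU` on the
  feeding side (`A < B` but `D₂ < D₁`) and `DUUD` on the fed side (every allowed partner of slot `2` precedes every
  allowed partner of slot `1`).

Uses c1 g5's F-B `FifoMatchingNFPolytopeQueueGridFaceFifo` (`lt_or_gt_of_mem_perfectMatchings`, `mem_arcs_of_gt`).
Honest framing: a step of input (A); K1 stays open; VP ≠ VNP is NOT proved by anything here.
-/

-- Sub = Summit single-conjunct layout: the duplicated namespace component is mandated by the tree.
set_option linter.dupNamespace false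

namespace Summit.ValiantsHypothesis.ValiantsHypothesis.Theorems.FifoMatching.NFPolytopeQuasiPolyXC.QueueGridFace

open Finset Literature.Computability.AlgebraicComplexity
open Summit.ValiantsHypothesis.ValiantsHypothesis.Theorems.FifoMatching.QueueGridFace

namespace QPos

variable {r d : ℕ}

/-! ### Virtual coordinates determine the position -/

/-- **The position as a function of the virtual cell coordinates** (piecewise in the virtual stretch). -/
theorem toNat_eq_of_vc (x : QPos r d) :
    x.toNat = if x.vc.1 = 0 then 2 * x.vc.2.1 + x.vc.2.2 - 3
      else if x.vc.1 ≤ r then (2 * r + 1) + (x.vc.1 - 1) * (4 * r + 2) + (4 * x.vc.2.1 + x.vc.2.2 - 3)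
      else if x.vc.1 = r + 1 then (2 * r + 1) * (2 * r + 1) + (2 * x.vc.2.1 + x.vc.2.2 - 2)
      else 2 * ((r + 1) * (2 * r + 1)) + x.vc.2.1 := by
  cases x with
  | pre j => simp only [vc, toNat]; split_ifs <;> first | contradiction | omega
  | frU s =>
    have := s.isLt; simp only [vc, toNat, Nat.add_sub_cancel]; split_ifs <;> first | contradiction | omega
  | slot s i t =>
    have := s.isLt; have := i.isLt; have := t.isLt
    simp only [vc, toNat, Nat.add_sub_cancel]; split_ifs <;> first | contradiction | omega
  | frD s =>
    have := s.isLt; simp only [vc, toNat, Nat.add_sub_cancel]; split_ifs <;> first | contradiction | omega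
  | post j => have := j.isLt; simp only [vc, toNat]; split_ifs <;> first | contradiction | omega
  | pad j => have := j.isLt; simp only [vc, toNat]; split_ifs <;> first | contradiction | omega

/-- **Virtual coordinates are injective.** -/
theorem eq_of_vc_eq {x y : QPos r d} (h : x.vc = y.vc) : x = y :=
  toNat_injective (by rw [toNat_eq_of_vc, toNat_eq_of_vc, h])

/-- Ranges of the virtual coordinates `(S, I, t)`: `t < 4`; preamble (`S = 0`) has `t ∈ {2,3}`, `I ≤ r`, and `I = 0`
only with `t = 3`; a real stretch (`1 ≤ S ≤ r`) has `I ≤ r+1`, `I = 0` only with `t = 3` (frame `U`) and `I = r+1`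
only with `t = 0` (frame `D`); the postamble (`S = r+1`) has `1 ≤ I ≤ r+1`, `t < 2`, and `I = r+1` only with `t = 0`;
padding has `S = r+2` and `t = 0`. -/
theorem vc_spec (x : QPos r d) :
    x.vc.2.2 < 4 ∧ x.vc.1 ≤ r + 2 ∧
    (x.vc.1 = 0 → 2 ≤ x.vc.2.2 ∧ x.vc.2.1 ≤ r ∧ (x.vc.2.1 = 0 → x.vc.2.2 = 3)) ∧
    (1 ≤ x.vc.1 → x.vc.1 ≤ r → x.vc.2.1 ≤ r + 1 ∧ (x.vc.2.1 = 0 → x.vc.2.2 = 3) ∧ (x.vc.2.1 = r + 1 → x.vc.2.2 = 0)) ∧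
    (x.vc.1 = r + 1 → x.vc.2.2 < 2 ∧ 1 ≤ x.vc.2.1 ∧ x.vc.2.1 ≤ r + 1 ∧ (x.vc.2.1 = r + 1 → x.vc.2.2 = 0)) ∧
    (x.vc.1 = r + 2 → x.vc.2.2 = 0) := by
  cases x with
  | pre j => have := j.isLt; dsimp only [vc]; omega
  | frU s => have := s.isLt; dsimp only [vc]; omega
  | slot s i t => have := s.isLt; have := i.isLt; have := t.isLt; dsimp only [vc]; omega
  | frD s => have := s.isLt; dsimp only [vc]; omega
  | post j => have := j.isLt; dsimp only [vc]; omega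
  | pad j => have := j.isLt; dsimp only [vc]; omega

/-- Only padding letters have virtual stretch `r + 2`. -/
theorem exists_pad_of_vc {x : QPos r d} (h : x.vc.1 = r + 2) : ∃ j, x = pad j := by
  cases x with
  | pre j => simp only [vc] at h; omega
  | frU s => have := s.isLt; simp only [vc] at h; omega
  | slot s i t => have := s.isLt; simp only [vc] at h; omega
  | frD s => have := s.isLt; simp only [vc] at h; omega
  | post j => simp only [vc] at h; omega
  | pad j => exact ⟨j, rfl⟩

/-- **Inside a virtual stretch, positions are ordered by column.** -/
theorem toNat_lt_of_vc {x y : QPos r d} (h1 : x.vc.1 = y.vc.1) (h2 : x.vc.2.1 < y.vc.2.1) : x.toNat < y.toNat := by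
  have hx := vc_spec x; have hy := vc_spec y
  rw [toNat_eq_of_vc x, toNat_eq_of_vc y, ← h1]
  rw [← h1] at hy
  split_ifs <;> omega

/-- Inside a virtual cell, positions are ordered by slot. -/
theorem toNat_lt_of_vc' {x y : QPos r d} (h1 : x.vc.1 = y.vc.1) (h2 : x.vc.2.1 = y.vc.2.1)
    (h3 : x.vc.2.2 < y.vc.2.2) : x.toNat < y.toNat := by
  have hx := vc_spec x; have hy := vc_spec y
  rw [toNat_eq_of_vc x, toNat_eq_of_vc y, ← h1, ← h2]
  rw [← h1] at hy; rw [← h2] at hy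
  split_ifs <;> omega

/-- Virtual coordinates are injective, componentwise form. -/
theorem eq_of_vc_eq' {x y : QPos r d} (h1 : x.vc.1 = y.vc.1) (h2 : x.vc.2.1 = y.vc.2.1) (h3 : x.vc.2.2 = y.vc.2.2) :
    x = y :=
  eq_of_vc_eq (Prod.ext h1 (Prod.ext h2 h3))

/-- virtual coordinates of a preamble letter -/
@[simp] theorem vc_pre (j : Fin (2 * r + 1)) : (pre j : QPos r d).vc = (0, (j.val + 1) / 2, 2 + (j.val + 1) % 2) := rfl

/-- virtual coordinates of a frame `U` -/
@[simp] theorem vc_frU (s : Fin r) : (frU s : QPos r d).vc = (s.val + 1, 0, 3) := rfl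

/-- virtual coordinates of a frame `D` -/
@[simp] theorem vc_frD (s : Fin r) : (frD s : QPos r d).vc = (s.val + 1, r + 1, 0) := rfl

/-- virtual coordinates of a postamble letter -/
@[simp] theorem vc_post (j : Fin (2 * r + 1)) : (post j : QPos r d).vc = (r + 1, j.val / 2 + 1, j.val % 2) := rfl

/-- virtual coordinates of a slot -/
@[simp] theorem vc_slot (s i : Fin r) (t : Fin 4) : (slot s i t : QPos r d).vc = (s.val + 1, i.val + 1, t.val) := rfl

/-- virtual coordinates of a padding letter -/
@[simp] theorem vc_pad (j : Fin (2 * d)) : (pad j : QPos r d).vc = (r + 2, j.val, 0) := rfl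

/-- A position with virtual coordinates `(s+1, i+1, t)`, `s, i < r`, is the slot `(s, i, t)`. -/
theorem eq_slot_of_vc {x : QPos r d} {s i : Fin r} (h1 : x.vc.1 = s.val + 1) (h2 : x.vc.2.1 = i.val + 1) :
    x = slot s i ⟨x.vc.2.2, (vc_spec x).1⟩ :=
  eq_of_vc_eq (by rw [vc_slot]; ext <;> simp [h1, h2])

/-! ### The arc rule unpacked -/

/-- the virtual-cell arc rule, as a proposition -/
theorem adjV_eq_true_iff (a b : ℕ × ℕ × ℕ) : adjV a b = true ↔
    b.1 = a.1 + 1 ∧ ((b.2.1 = a.2.1 ∧ a.2.2 % 2 = 0 ∧ b.2.2 % 2 = 1) ∨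
      (b.2.1 = a.2.1 + 1 ∧ a.2.2 % 2 = 1 ∧ b.2.2 % 2 = 0)) := by
  simp [adjV, and_assoc]

/-- **The allowed-arc relation unpacked**: a padding arc `pad 2u → pad (2u+1)`, or the virtual-cell rule between two
non-padding positions. -/
theorem adj_eq_true_iff (x y : QPos r d) : adj x y = true ↔
    (∃ j j' : Fin (2 * d), x = pad j ∧ y = pad j' ∧ j.val % 2 = 0 ∧ j'.val = j.val + 1) ∨
    ((∀ j, x ≠ pad j) ∧ (∀ j, y ≠ pad j) ∧ adjV x.vc y.vc = true) := by
  cases x <;> cases y <;> simp [adj]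

/-- An arc out of a non-padding position `x` follows the virtual-cell rule and ends at a non-padding position. -/
theorem adjV_of_adj {x y : QPos r d} (h : adj x y = true) (hx : x.vc.1 ≤ r + 1) :
    y.vc.1 ≤ r + 1 ∧ adjV x.vc y.vc = true := by
  rcases (adj_eq_true_iff x y).1 h with ⟨j, j', rfl, rfl, -, -⟩ | ⟨-, hy, hV⟩
  · simp [vc] at hx
  · refine ⟨?_, hV⟩
    have := (vc_spec y).2.1
    have hne : ¬ y.vc.1 = r + 2 := fun e => by obtain ⟨j, rfl⟩ := exists_pad_of_vc e; exact hy j rfl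
    omega

/-- An arc into a non-padding position `y` follows the virtual-cell rule and starts at a non-padding position. -/
theorem adjV_of_adj' {x y : QPos r d} (h : adj x y = true) (hy : y.vc.1 ≤ r + 1) :
    x.vc.1 ≤ r + 1 ∧ adjV x.vc y.vc = true := by
  rcases (adj_eq_true_iff x y).1 h with ⟨j, j', rfl, rfl, -, -⟩ | ⟨hx, -, hV⟩
  · simp [vc] at hy
  · refine ⟨?_, hV⟩
    have := (vc_spec x).2.1
    have hne : ¬ x.vc.1 = r + 2 := fun e => by obtain ⟨j, rfl⟩ := exists_pad_of_vc e; exact hx j rfl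
    omega

/-- **Arcs into a slot** come from the virtual cell class `(s, i, odd)` (even slots) or `(s, i+1, even)` (odd slots). -/
theorem vc_of_adj_slot {x : QPos r d} {s i : Fin r} {t : Fin 4} (h : adj x (slot s i t) = true) :
    x.vc.1 = s.val ∧ ((x.vc.2.1 = i.val ∧ x.vc.2.2 % 2 = 1 ∧ t.val % 2 = 0) ∨
      (x.vc.2.1 = i.val + 1 ∧ x.vc.2.2 % 2 = 0 ∧ t.val % 2 = 1)) := by
  have := s.isLt
  obtain ⟨-, hV⟩ := adjV_of_adj' h (by simp only [vc_slot]; omega)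
  simp only [adjV_eq_true_iff, vc_slot] at hV
  omega

/-- **Arcs out of the class `(s, i, odd)`** (`s, i < r`) end at an even slot of window `(s, i)`. -/
theorem eq_slot_of_adj_odd {x y : QPos r d} {s i : Fin r} (h : adj x y = true)
    (h1 : x.vc.1 = s.val) (h2 : x.vc.2.1 = i.val) (h3 : x.vc.2.2 % 2 = 1) :
    y = slot s i ⟨y.vc.2.2, (vc_spec y).1⟩ ∧ y.vc.2.2 % 2 = 0 := by
  have := s.isLt
  obtain ⟨-, hV⟩ := adjV_of_adj h (by omega)
  rw [adjV_eq_true_iff] at hV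
  have h4 : y.vc.1 = s.val + 1 ∧ y.vc.2.1 = i.val + 1 ∧ y.vc.2.2 % 2 = 0 := by omega
  exact ⟨eq_slot_of_vc h4.1 h4.2.1, h4.2.2⟩

/-- **Arcs out of the class `(s, i+1, even)`** (`s, i < r`) end at an odd slot of window `(s, i)`. -/
theorem eq_slot_of_adj_even {x y : QPos r d} {s i : Fin r} (h : adj x y = true)
    (h1 : x.vc.1 = s.val) (h2 : x.vc.2.1 = i.val + 1) (h3 : x.vc.2.2 % 2 = 0) :
    y = slot s i ⟨y.vc.2.2, (vc_spec y).1⟩ ∧ y.vc.2.2 % 2 = 1 := by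
  have := s.isLt
  obtain ⟨-, hV⟩ := adjV_of_adj h (by omega)
  rw [adjV_eq_true_iff] at hV
  have h4 : y.vc.1 = s.val + 1 ∧ y.vc.2.1 = i.val + 1 ∧ y.vc.2.2 % 2 = 1 := by omega
  exact ⟨eq_slot_of_vc h4.1 h4.2.1, h4.2.2⟩

end QPos

/-! ### A nest-free matching supported on the allowed arcs, seen at symbolic positions -/

section Matching

variable {r d : ℕ} {M : Fin (2 * half r d) → Fin (2 * half r d)}

/-- membership in `allowed` at arbitrary positions -/
theorem mem_allowed_iff' (p q : Fin (2 * half r d)) :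
    (p, q) ∈ allowed r d ↔ QPos.adj (QPos.ofFin p) (QPos.ofFin q) = true := by
  simp [allowed]

/-- **FIFO monotonicity**: in a nest-free perfect matching, of two openers the earlier one closes earlier. -/
theorem apply_lt_apply_of_lt (hM : M ∈ nestFreeMatchings (2 * half r d)) {p q : Fin (2 * half r d)}
    (hpq : p < q) (hq : q < M q) : M p < M q := by
  obtain ⟨hPM, hnest⟩ := mem_nestFreeMatchings.1 hM
  have hinj : Function.Injective M := Function.Involutive.injective (mem_perfectMatchings.1 hPM).1
  rcases lt_trichotomy (M p) (M q) with h | h | h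
  · exact h
  · exact absurd (hinj h) hpq.ne
  · exact (hnest p q hpq hq h).elim

/-- The arc at an opener `x`, symbolically: `x → ofFin (M x)` is an allowed arc. -/
theorem adj_of_lt (hE : ∀ p, p < M p → (p, M p) ∈ allowed r d) (x : QPos r d) (hx : x.toFin < M x.toFin) :
    QPos.adj x (QPos.ofFin (M x.toFin)) = true := by
  have := (mem_allowed_iff' _ _).1 (hE _ hx)
  rwa [QPos.ofFin_toFin] at this

/-- The arc at a closer `x`, symbolically: `ofFin (M x) → x` is an allowed arc. -/
theorem adj_of_gt (hM : M ∈ nestFreeMatchings (2 * half r d)) (hE : ∀ p, p < M p → (p, M p) ∈ allowed r d)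
    (x : QPos r d) (hx : M x.toFin < x.toFin) : QPos.adj (QPos.ofFin (M x.toFin)) x = true := by
  have hPM := nestFreeMatchings_subset_perfectMatchings hM
  have h := mem_arcs_of_gt hPM (E := (allowed r d : Set _)) (fun i hi => Finset.mem_coe.2 (hE i hi)) hx
  rw [Finset.mem_coe, mem_allowed_iff', QPos.ofFin_toFin] at h
  exact h

/-- A position without incoming allowed arcs is an opener. -/
theorem lt_of_no_adj_in (hM : M ∈ nestFreeMatchings (2 * half r d))
    (hE : ∀ p, p < M p → (p, M p) ∈ allowed r d) (x : QPos r d) (h : ∀ z : QPos r d, QPos.adj z x = false) :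
    x.toFin < M x.toFin := by
  refine lt_of_forall_not_mem (nestFreeMatchings_subset_perfectMatchings hM) (E := (allowed r d : Set _))
    (fun i hi => Finset.mem_coe.2 (hE i hi)) fun i hi => ?_
  rw [Finset.mem_coe, mem_allowed_iff', QPos.ofFin_toFin, h] at hi
  exact Bool.false_ne_true hi

/-- A position without outgoing allowed arcs is a closer. -/
theorem gt_of_no_adj_out (hM : M ∈ nestFreeMatchings (2 * half r d))
    (hE : ∀ p, p < M p → (p, M p) ∈ allowed r d) (x : QPos r d) (h : ∀ z : QPos r d, QPos.adj x z = false) :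
    M x.toFin < x.toFin := by
  refine gt_of_forall_not_mem (nestFreeMatchings_subset_perfectMatchings hM) (E := (allowed r d : Set _))
    (fun i hi => Finset.mem_coe.2 (hE i hi)) fun i hi => ?_
  rw [Finset.mem_coe, mem_allowed_iff', QPos.ofFin_toFin, h] at hi
  exact Bool.false_ne_true hi

/-- the partner of the partner -/
theorem apply_apply (hM : M ∈ nestFreeMatchings (2 * half r d)) (p : Fin (2 * half r d)) : M (M p) = p :=
  (mem_perfectMatchings.1 (nestFreeMatchings_subset_perfectMatchings hM)).1 p

/-- **THE FEEDING LEMMA.**  Let `M` be a nest-free perfect matching supported on the allowed arcs, and let window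
`(s, i)` have its two feeders: an opener `A` which is the ONLY opener in the virtual cell class `(s, i, odd)` (these are
the positions with an allowed arc into the even slots of the window) and an opener `B` which is the only opener in the
class `(s, i+1, even)` (arcs into the odd slots), with `A` before `B`.  Then the window reads `UUDD` or `DDUU`:
slot `t` is an opener iff (`t < 2` iff slot `0` is an opener). -/
theorem window_pattern (hM : M ∈ nestFreeMatchings (2 * half r d))
    (hE : ∀ p, p < M p → (p, M p) ∈ allowed r d) (s i : Fin r) (A B : QPos r d)
    (hA : A.toFin < M A.toFin) (hAv : A.vc.1 = s.val ∧ A.vc.2.1 = i.val ∧ A.vc.2.2 % 2 = 1)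
    (hAu : ∀ x : QPos r d, x.toFin < M x.toFin → x.vc.1 = s.val → x.vc.2.1 = i.val → x.vc.2.2 % 2 = 1 → x = A)
    (hB : B.toFin < M B.toFin) (hBv : B.vc.1 = s.val ∧ B.vc.2.1 = i.val + 1 ∧ B.vc.2.2 % 2 = 0)
    (hBu : ∀ x : QPos r d, x.toFin < M x.toFin → x.vc.1 = s.val → x.vc.2.1 = i.val + 1 → x.vc.2.2 % 2 = 0 → x = B)
    (hAB : A.toNat < B.toNat) (t : Fin 4) :
    (QPos.slot s i t).toFin < M (QPos.slot s i t).toFin ↔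
      (t.val < 2 ↔ (QPos.slot s i 0).toFin < M (QPos.slot s i 0).toFin) := by
  -- the partners of the feeders are slots of the window, of the right parities
  obtain ⟨hMA, htA⟩ := QPos.eq_slot_of_adj_odd (adj_of_lt hE A hA) hAv.1 hAv.2.1 hAv.2.2
  obtain ⟨hMB, htB⟩ := QPos.eq_slot_of_adj_even (adj_of_lt hE B hB) hBv.1 hBv.2.1 hBv.2.2
  set tA : Fin 4 := ⟨(QPos.ofFin (M A.toFin)).vc.2.2, (QPos.vc_spec _).1⟩ with htAdef
  set tB : Fin 4 := ⟨(QPos.ofFin (M B.toFin)).vc.2.2, (QPos.vc_spec _).1⟩ with htBdef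
  have hMA' : M A.toFin = (QPos.slot s i tA).toFin := by rw [← hMA, QPos.toFin_ofFin]
  have hMB' : M B.toFin = (QPos.slot s i tB).toFin := by rw [← hMB, QPos.toFin_ofFin]
  have htA' : tA.val % 2 = 0 := htA
  have htB' : tB.val % 2 = 1 := htB
  -- FIFO on the feeders: D₁ before D₂
  have hAB' : tA.val < tB.val := by
    have h := apply_lt_apply_of_lt hM (show A.toFin < B.toFin from hAB) hB
    rw [hMA', hMB', QPos.toFin_lt_toFin] at h
    simp only [QPos.toNat] at h
    omega
  -- the fed slots are closers
  have hcl : ∀ (C : QPos r d) (tc : Fin 4), C.toFin < M C.toFin → M C.toFin = (QPos.slot s i tc).toFin →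
      ¬ (QPos.slot s i tc).toFin < M (QPos.slot s i tc).toFin := by
    intro C tc hC hMC hlt
    rw [← hMC, apply_apply hM] at hlt
    exact lt_asymm hC hlt
  -- the other slot of each parity is an opener
  have hopA : ∀ tc : Fin 4, tc.val % 2 = 0 → tc ≠ tA → (QPos.slot s i tc).toFin < M (QPos.slot s i tc).toFin := by
    intro tc htc hne
    rcases lt_or_gt_of_mem_perfectMatchings (nestFreeMatchings_subset_perfectMatchings hM)
      (QPos.slot s i tc).toFin with h | h
    · exact h
    · exfalso
      have hz := adj_of_gt hM hE _ h
      obtain ⟨hz1, hz2⟩ := QPos.vc_of_adj_slot hz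
      have hz3 : (QPos.ofFin (M (QPos.slot s i tc).toFin)).vc.2.1 = i.val ∧
          (QPos.ofFin (M (QPos.slot s i tc).toFin)).vc.2.2 % 2 = 1 := by omega
      have hzo : (QPos.ofFin (M (QPos.slot s i tc).toFin)).toFin < M (QPos.ofFin (M (QPos.slot s i tc).toFin)).toFin := by
        rw [QPos.toFin_ofFin, apply_apply hM]; exact h
      have hzA := hAu _ hzo hz1 hz3.1 hz3.2
      have : M A.toFin = (QPos.slot s i tc).toFin := by rw [← hzA, QPos.toFin_ofFin, apply_apply hM]
      rw [hMA', QPos.toFin_inj] at this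
      exact hne (by cases this; rfl)
  have hopB : ∀ tc : Fin 4, tc.val % 2 = 1 → tc ≠ tB → (QPos.slot s i tc).toFin < M (QPos.slot s i tc).toFin := by
    intro tc htc hne
    rcases lt_or_gt_of_mem_perfectMatchings (nestFreeMatchings_subset_perfectMatchings hM)
      (QPos.slot s i tc).toFin with h | h
    · exact h
    · exfalso
      have hz := adj_of_gt hM hE _ h
      obtain ⟨hz1, hz2⟩ := QPos.vc_of_adj_slot hz
      have hz3 : (QPos.ofFin (M (QPos.slot s i tc).toFin)).vc.2.1 = i.val + 1 ∧
          (QPos.ofFin (M (QPos.slot s i tc).toFin)).vc.2.2 % 2 = 0 := by omega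
      have hzo : (QPos.ofFin (M (QPos.slot s i tc).toFin)).toFin < M (QPos.ofFin (M (QPos.slot s i tc).toFin)).toFin := by
        rw [QPos.toFin_ofFin, apply_apply hM]; exact h
      have hzB := hBu _ hzo hz1 hz3.1 hz3.2
      have : M B.toFin = (QPos.slot s i tc).toFin := by rw [← hzB, QPos.toFin_ofFin, apply_apply hM]
      rw [hMB', QPos.toFin_inj] at this
      exact hne (by cases this; rfl)
  -- the case `D U U D` is impossible: the pushes of slots 1 and 2 would nest
  have hnot03 : ¬ (tA.val = 0 ∧ tB.val = 3) := by
    rintro ⟨h0, h3⟩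
    have h1 : (QPos.slot s i 1).toFin < M (QPos.slot s i 1).toFin :=
      hopB 1 (by simp) (fun e => by have := congrArg Fin.val e; simp at this; omega)
    have h2 : (QPos.slot s i 2).toFin < M (QPos.slot s i 2).toFin :=
      hopA 2 (by simp) (fun e => by have := congrArg Fin.val e; simp at this; omega)
    have h12 := apply_lt_apply_of_lt hM (show (QPos.slot s i 1 : QPos r d).toFin < (QPos.slot s i 2).toFin by
      simp [QPos.toNat]) h2
    -- partners: slot 1 (odd) → class (s+1, i+2, even); slot 2 (even) → class (s+1, i+1, odd)
    have hs := s.isLt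
    obtain ⟨-, hV1⟩ := QPos.adjV_of_adj (adj_of_lt hE _ h1) (by simp only [QPos.vc_slot]; omega)
    obtain ⟨-, hV2⟩ := QPos.adjV_of_adj (adj_of_lt hE _ h2) (by simp only [QPos.vc_slot]; omega)
    simp only [QPos.adjV_eq_true_iff, QPos.vc_slot] at hV1 hV2
    have hlt := QPos.toNat_lt_of_vc (x := QPos.ofFin (M (QPos.slot s i 2).toFin))
      (y := QPos.ofFin (M (QPos.slot s i 1).toFin)) (by omega) (by omega)
    rw [← QPos.toFin_lt_toFin, QPos.toFin_ofFin, QPos.toFin_ofFin] at hlt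
    exact lt_asymm h12 hlt
  -- read off the pattern
  have h0A : tA.val = 0 ∨ tA.val = 2 := by have := tA.isLt; omega
  have h0B : tB.val = 1 ∨ tB.val = 3 := by have := tB.isLt; omega
  have hcA := hcl A tA hA hMA'
  have hcB := hcl B tB hB hMB'
  rcases h0A with hA0 | hA2
  · -- tA = 0, so tB = 1: pattern D D U U
    have hB1 : tB.val = 1 := by rcases h0B with h | h; exact h; exact (hnot03 ⟨hA0, h⟩).elim
    have e0 : tA = 0 := Fin.ext hA0
    have e1 : tB = 1 := Fin.ext hB1
    rw [e0] at hcA; rw [e1] at hcB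
    have h2 := hopA 2 (by simp) (by rw [e0]; simp)
    have h3 := hopB 3 (by simp) (by rw [e1]; simp)
    fin_cases t <;> simp [hcA, hcB, h2, h3]
  · -- tA = 2, so tB = 3: pattern U U D D
    have hB3 : tB.val = 3 := by omega
    have e2 : tA = 2 := Fin.ext hA2
    have e3 : tB = 3 := Fin.ext hB3
    rw [e2] at hcA; rw [e3] at hcB
    have h0 := hopA 0 (by simp) (by rw [e2]; simp)
    have h1 := hopB 1 (by simp) (by rw [e3]; simp)
    fin_cases t <;> simp [hcA, hcB, h0, h1]

end Matching

end Summit.ValiantsHypothesis.ValiantsHypothesis.Theorems.FifoMatching.NFPolytopeQuasiPolyXC.QueueGridFace
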